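import Summits.AtomisticToContinuum.HydrodynamicLimit.Theorems.LambertianContactSwapCollisionMomentBoundBridge
import Summits.AtomisticToContinuum.HydrodynamicLimit.Theorems.LambertianContactSwapCollisionMomentBoundFlux
import Summits.AtomisticToContinuum.HydrodynamicLimit.Theorems.JParityClosureCollisionTightnessSweptTube
import Summits.AtomisticToContinuum.HydrodynamicLimit.Theorems.JParityClosureCollisionTightnessTorusGibbs
import Summits.AtomisticToContinuum.HydrodynamicLimit.Theorems.JParityClosureOddContactSymmetryGibbsInvariance
import Literature.MathematicalPhysics.KineticTheory.HardSphereCanonicalPairBound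
import Literature.MathematicalPhysics.KineticTheory.HardSphereTwoTimePressure
import HarnessLib

/-!
# `LambertianContactSwap.CollisionMomentBound` (stmt-AtomisticToContinuum-12102), rung 0:
# the `|g|³`-weighted collision count has bounded mean under the homogeneous Gibbs law, uniformly in `N`

Helper file (`--supports stmt-AtomisticToContinuum-12102`).  The support item `CollisionMomentBound` of
route `LambertianContactSwap` asks, for LOCAL Gibbs data with continuous profiles `(a₀, u₀, θ₀)`, for a
bound `E_{P_N}[(N+1)^{-4/3} Σ_{collisions k ≤ t} (1 + |g_k|³)] ≤ C` uniform in `N` (deterministic hard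
spheres of diameter `ε_N = σ (N+1)^{-1/3}` on `𝕋³`, collisions read off Alexander's construction).  This
file PROVES the constant-profile instance (`collisionMomentBound_const`: the body of the route decl
verbatim with `a₀ ≡ a`, `u₀ ≡ u`, `θ₀ ≡ θ`), where the local Gibbs law is the homogeneous canonical Gibbs
law `G_N`, stationary under every hard-sphere flow:

* `lintegral_cubicFluxMoment_ne_top` — the flux-weighted Gaussian cubic moment
  `I(u, θ) = ∫ ‖w − v‖ (1 + ‖v − w‖³) dN(u,θ)(v) dN(u,θ)(w)` is finite (quartic Gaussian moments);
* `rpow_mul_sq_mul_hsDiameter_sq` — `(N+1)^{-4/3} · (N+1)² ε_N² = σ²`: the item's normalisation is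
  exactly the one of the Boltzmann–Enskog collision flux at fixed reduced density;
* `lintegral_ofReal_mul_le` — bookkeeping (`∫⁻ ofReal (c · S) ≤ ofReal c · B` from an a.e. pathwise
  domination on the good set and a bound for the dominating functional);
* `collisionMomentBound_const` — for `a, θ > 0`, `u`: `∃ σ₀ > 0 ∀ 0 < σ < σ₀ ∀ Φ ∀ t ≥ 0 ∃ C ∀ N`,
  `∫⁻ ofReal ((N+1)^{-4/3} Σ_{m < K_t(z)} Σ_{i,j} [hit y_m i j] (1 + ‖vᵢ − vⱼ‖³)) dG_N ≤ ofReal C` with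
  `C = 16 (t+1) σ² I(u, θ)`, by the bridge `ofReal_hitSum_le_collisionSum_flow` (the item's sum over
  Alexander's construction is dominated by the trajectory collision sum of the collision-invariant mark
  `1 + ‖vᵢ − vⱼ‖³`), the mean form of the collision-flux window bound
  `lintegral_indicator_collisionMarkSum_le` (Cercignani–Illner–Pulvirenti 1994 App. 4.A) fed with the
  swept tube (`exists_sweptTube`), the minimal-image lift inequality
  (`volume_setOf_exists_reprSym_add_latticeVec_mem_le`), the Ruelle-type pair bound
  (`posGibbs_pairEvent_le` at small reduced density `exists_smallDensity`) and the invariance of `G_N`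
  (`measurePreserving_flow_localGibbsLaw_const`).

What is NOT proved, and why.  The item AS FILED (non-constant continuous profiles) is an open-type
estimate: the local Gibbs law is not invariant, its only known comparison with an invariant law costs
`Λ^{N+1}` (`exists_localGibbsMeasure_le_smul_const`; relative entropy of order `N`), and for the CUBIC
weight even the speed-`N` exponential upper tails of the equilibrium functional that such a transfer
would need are false (one sphere of speed `V ≍ N^{4/9}` already moves `(N+1)^{-4/3} Σ |g|³` by `O(1)` at
Gaussian cost `e^{-O(N^{8/9})} ≫ Λ^{-(N+1)}`), so a genuinely non-equilibrium control of the collision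
flux of the deterministic dynamics is required — not in print (see the evidence memo on the item).

References: C. Cercignani, R. Illner, M. Pulvirenti, *The Mathematical Theory of Dilute Gases* (1994),
App. 4.A; H. Spohn, *Large Scale Dynamics of Interacting Particles* (1991), Part I §2.3–§3;
I. Gallagher, L. Saint-Raymond, B. Texier, *From Newton to Boltzmann* (2013), Prop. 4.1.1.
-/

noncomputable section

open MeasureTheory Set Filter Topology
open scoped ENNReal InnerProductSpace BigOperators Classical

namespace Summit.AtomisticToContinuum.HydrodynamicLimit.Theorems.LambertianContactSwapCollisionMomentBound

open Literature.Analysis.FluidPDE Literature.Analysis.FunctionSpaces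
  Literature.MathematicalPhysics.KineticTheory

/-! ### The flux-weighted Gaussian cubic moment is finite -/

/-- For `0 ≤ r ≤ a + b`: `r (1 + r³) ≤ (a + 8 a⁴) + (b + 8 b⁴)` (since `r⁴ ≤ (a + b)⁴ ≤ 8 (a⁴ + b⁴)`).
[folklore] -/
theorem mul_one_add_cube_le {r a b : ℝ} (hr : 0 ≤ r) (hrab : r ≤ a + b) :
    r * (1 + r ^ 3) ≤ (a + 8 * a ^ 4) + (b + 8 * b ^ 4) := by
  have h4 : r ^ 4 ≤ (a + b) ^ 4 := by
    have h2 : r ^ 2 ≤ (a + b) ^ 2 := by nlinarith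
    nlinarith [h2, sq_nonneg r, sq_nonneg (a + b)]
  have hab4 : (a + b) ^ 4 ≤ 8 * (a ^ 4 + b ^ 4) := by
    nlinarith [sq_nonneg (a - b), sq_nonneg (a + b), sq_nonneg (a ^ 2 - b ^ 2),
      mul_self_nonneg ((a - b) * (a + b))]
  nlinarith [h4, hab4]

/-- `‖v‖ + 8 ‖v‖⁴` is integrable under the Gaussian `N(u, θ)` (quartic Gaussian moments, Fernique).
[folklore] -/
theorem integrable_norm_add_norm_pow_four (u : V3) (θ : ℝ) :
    Integrable (fun v : V3 => ‖v‖ + 8 * ‖v‖ ^ 4) (gaussMeasure u θ) := by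
  have h1 : Integrable (fun v : V3 => ‖v‖) (gaussMeasure u θ) := by
    have := (ProbabilityTheory.IsGaussian.memLp_id (gaussMeasure u θ) ((1 : ℕ) : ℝ≥0∞)
      (by simp)).integrable_norm_pow one_ne_zero
    simpa using this
  have h4 : Integrable (fun v : V3 => ‖v‖ ^ 4) (gaussMeasure u θ) := by
    have := (ProbabilityTheory.IsGaussian.memLp_id (gaussMeasure u θ) ((4 : ℕ) : ℝ≥0∞)
      (by simp)).integrable_norm_pow (by norm_num)
    simpa using this
  exact h1.add (h4.const_mul 8)

/-- **The flux-weighted Gaussian cubic moment is finite**: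
`∫ ‖w − v‖ · (1 + ‖v − w‖³) dN(u,θ)(v) dN(u,θ)(w) < ∞`. [folklore] -/
theorem lintegral_cubicFluxMoment_ne_top (u : V3) (θ : ℝ) :
    ∫⁻ p, ENNReal.ofReal ‖p.2 - p.1‖ * ENNReal.ofReal (1 + ‖p.1 - p.2‖ ^ 3)
        ∂((gaussMeasure u θ).prod (gaussMeasure u θ)) ≠ ⊤ := by
  set γ := gaussMeasure u θ with hγ
  set g : V3 → ℝ := fun v => ‖v‖ + 8 * ‖v‖ ^ 4 with hg
  have hg0 : ∀ v, 0 ≤ g v := fun v => by rw [hg]; positivity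
  have hgi : Integrable g γ := integrable_norm_add_norm_pow_four u θ
  have hgm : Measurable fun v : V3 => ENNReal.ofReal (g v) := by rw [hg]; fun_prop
  have hle : ∀ p : V3 × V3, ENNReal.ofReal ‖p.2 - p.1‖ * ENNReal.ofReal (1 + ‖p.1 - p.2‖ ^ 3) ≤
      ENNReal.ofReal (g p.1) + ENNReal.ofReal (g p.2) := by
    intro p
    rw [← ENNReal.ofReal_mul (norm_nonneg _), ← ENNReal.ofReal_add (hg0 p.1) (hg0 p.2)]
    refine ENNReal.ofReal_le_ofReal ?_
    have h1 : ‖p.2 - p.1‖ ≤ ‖p.1‖ + ‖p.2‖ := by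
      calc ‖p.2 - p.1‖ ≤ ‖p.2‖ + ‖p.1‖ := norm_sub_le _ _
        _ = ‖p.1‖ + ‖p.2‖ := add_comm _ _
    have h2 : ‖p.1 - p.2‖ = ‖p.2 - p.1‖ := norm_sub_rev _ _
    rw [h2]
    exact mul_one_add_cube_le (norm_nonneg _) h1
  have h1 : ∫⁻ p, ENNReal.ofReal (g p.1) ∂(γ.prod γ) = ∫⁻ v, ENNReal.ofReal (g v) ∂γ := by
    calc ∫⁻ p, ENNReal.ofReal (g p.1) ∂(γ.prod γ)
        = ∫⁻ v, ∫⁻ _w, ENNReal.ofReal (g v) ∂γ ∂γ := lintegral_prod _ (hgm.comp measurable_fst).aemeasurable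
      _ = ∫⁻ v, ENNReal.ofReal (g v) ∂γ := by simp only [lintegral_const, measure_univ, mul_one]
  have h2 : ∫⁻ p, ENNReal.ofReal (g p.2) ∂(γ.prod γ) = ∫⁻ v, ENNReal.ofReal (g v) ∂γ := by
    calc ∫⁻ p, ENNReal.ofReal (g p.2) ∂(γ.prod γ)
        = ∫⁻ _v, ∫⁻ w, ENNReal.ofReal (g w) ∂γ ∂γ := lintegral_prod _ (hgm.comp measurable_snd).aemeasurable
      _ = ∫⁻ v, ENNReal.ofReal (g v) ∂γ := by simp only [lintegral_const, measure_univ, mul_one]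
  have hfin : ∫⁻ v, ENNReal.ofReal (g v) ∂γ < ⊤ := hgi.lintegral_lt_top
  refine ne_of_lt ?_
  calc ∫⁻ p, ENNReal.ofReal ‖p.2 - p.1‖ * ENNReal.ofReal (1 + ‖p.1 - p.2‖ ^ 3) ∂(γ.prod γ)
      ≤ ∫⁻ p, (ENNReal.ofReal (g p.1) + ENNReal.ofReal (g p.2)) ∂(γ.prod γ) := lintegral_mono hle
    _ = ∫⁻ v, ENNReal.ofReal (g v) ∂γ + ∫⁻ v, ENNReal.ofReal (g v) ∂γ := by
        rw [lintegral_add_left (show Measurable (fun p : V3 × V3 => ENNReal.ofReal (g p.1)) from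
          hgm.comp measurable_fst), h1, h2]
    _ < ⊤ := ENNReal.add_lt_top.2 ⟨hfin, hfin⟩

/-! ### The normalisation and a bookkeeping lemma -/

/-- **The item's normalisation is the Boltzmann–Enskog one**: `(N+1)^{-4/3} · (N+1)² · ε_N² = σ²` for
`ε_N = σ (N+1)^{-1/3}` (`(N+1)²/2` pairs, contact cross-section `∝ ε_N²`, so `≍ σ² (N+1)^{4/3}`
collisions per unit time). [folklore] -/
theorem rpow_mul_sq_mul_hsDiameter_sq (σ : ℝ) (N : ℕ) :
    ((N : ℝ) + 1) ^ (-(4 / 3 : ℝ)) * ((N + 1 : ℕ) : ℝ) ^ 2 * hsDiameter σ N ^ 2 = σ ^ 2 := by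
  have hx : (0 : ℝ) < (N : ℝ) + 1 := by positivity
  have hcast : ((N + 1 : ℕ) : ℝ) = (N : ℝ) + 1 := by push_cast; ring
  have hkey : ((N : ℝ) + 1) ^ (-(4 / 3 : ℝ)) * ((N : ℝ) + 1) ^ (2 : ℝ) *
      (((N : ℝ) + 1) ^ (-(1 / 3 : ℝ))) ^ (2 : ℝ) = 1 := by
    rw [← Real.rpow_mul hx.le, ← Real.rpow_add hx, ← Real.rpow_add hx]
    norm_num
  rw [hsDiameter, hcast, mul_pow, ← Real.rpow_two ((N : ℝ) + 1),
    ← Real.rpow_two (((N : ℝ) + 1) ^ (-(1 / 3 : ℝ)))]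
  calc ((N : ℝ) + 1) ^ (-(4 / 3 : ℝ)) * ((N : ℝ) + 1) ^ (2 : ℝ) *
        (σ ^ 2 * (((N : ℝ) + 1) ^ (-(1 / 3 : ℝ))) ^ (2 : ℝ))
      = σ ^ 2 * (((N : ℝ) + 1) ^ (-(4 / 3 : ℝ)) * ((N : ℝ) + 1) ^ (2 : ℝ) *
          (((N : ℝ) + 1) ^ (-(1 / 3 : ℝ))) ^ (2 : ℝ)) := by ring
    _ = σ ^ 2 := by rw [hkey, mul_one]

/-- Bookkeeping: if `ofReal (S z) ≤ K z` on a set `good` of full `P`-measure and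
`∫⁻ 𝟙_{good} K dP ≤ B`, then `∫⁻ ofReal (c · S) dP ≤ ofReal c · B` for every constant `c ≥ 0`
(no measurability of `S` or `K` is needed). [folklore] -/
theorem lintegral_ofReal_mul_le {α : Type*} [MeasurableSpace α] (P : Measure α) {c : ℝ} (hc : 0 ≤ c)
    {good : Set α} (hgood : ∀ᵐ z ∂P, z ∈ good) {S : α → ℝ} {K : α → ℝ≥0∞} {B : ℝ≥0∞}
    (h2 : ∫⁻ z, good.indicator K z ∂P ≤ B) (h1 : ∀ z ∈ good, ENNReal.ofReal (S z) ≤ K z) :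
    ∫⁻ z, ENNReal.ofReal (c * S z) ∂P ≤ ENNReal.ofReal c * B := by
  calc ∫⁻ z, ENNReal.ofReal (c * S z) ∂P = ∫⁻ z, ENNReal.ofReal c * ENNReal.ofReal (S z) ∂P := by
        simp only [ENNReal.ofReal_mul hc]
    _ = ENNReal.ofReal c * ∫⁻ z, ENNReal.ofReal (S z) ∂P :=
        lintegral_const_mul' _ _ ENNReal.ofReal_ne_top
    _ ≤ ENNReal.ofReal c * ∫⁻ z, good.indicator K z ∂P := by
        refine mul_le_mul' le_rfl (lintegral_mono_ae (hgood.mono fun z hz => ?_))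
        rw [indicator_of_mem hz]
        exact h1 z hz
    _ ≤ ENNReal.ofReal c * B := mul_le_mul' le_rfl h2

/-! ### Rung 0: the constant-profile instance of `CollisionMomentBound` -/

/-- **`LambertianContactSwap.CollisionMomentBound` at rung 0 (constant profiles = the flow-invariant
homogeneous Gibbs law).** For `a, θ > 0`, `u`, there is `σ₀ > 0` such that for every `0 < σ < σ₀`,
every family of hard-sphere flows `Φ_N` of `N + 1` spheres of diameter `ε_N = hsDiameter σ N` on `𝕋³`
and every `t ≥ 0` there is `C` (here `C = 16 (t+1) σ² I(u,θ)`) with, for ALL `N`,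
`∫⁻ ofReal ((N+1)^{-4/3} Σ_{m < K_t(z)} Σ_{i,j} [hit y_m i j] (1 + ‖vᵢ(y_m) − vⱼ(y_m)‖³)) dG_N(z) ≤ ofReal C`,
`G_N = localGibbsLaw σ a u θ N Φ_N`, where — exactly as in the route decl — `K_t = Alexander.collisionCount`,
`y_m = S_{τ(z_m)} z_m` is the pre-collisional exit configuration of `z_m = Alexander.stateAfter z m`
and `hit y i j = (i < j ∧ y ∈ contactSet i j ∧ IsIncoming y i j)`: the body of `CollisionMomentBound`
with constant profiles.  Proof: on the good set (full measure, `ae_mem_good_localGibbsLaw`) the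
`hit`-sum is dominated by the trajectory collision sum of the collision-invariant mark `1 + ‖vᵢ − vⱼ‖³`
(`ofReal_hitSum_le_collisionSum_flow`), whose mean under the invariant law `G_N` is at most
`16 (t+1) (N+1)² ε_N² I` (`lintegral_indicator_collisionMarkSum_le`), and
`(N+1)^{-4/3} (N+1)² ε_N² = σ²`. [folklore] -/
theorem collisionMomentBound_const {a θ : ℝ} (ha : 0 < a) (hθ : 0 < θ) (u : V3) :
    ∃ σ₀ : ℝ, 0 < σ₀ ∧ ∀ σ : ℝ, 0 < σ → σ < σ₀ →
      ∀ Φ : (N : ℕ) → HardSphereFlow (Torus.geometry (Fin 3)) (hsDiameter σ N) (N + 1),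
      ∀ t : ℝ, 0 ≤ t → ∃ C : ℝ, ∀ N : ℕ,
        ∫⁻ z, ENNReal.ofReal (((N : ℝ) + 1) ^ (-(4 / 3 : ℝ)) *
          ∑ m ∈ Finset.range (Alexander.collisionCount (Torus.geometry (Fin 3)) (hsDiameter σ N) z t),
            ∑ i : Fin (N + 1), ∑ j : Fin (N + 1),
              (if i < j ∧
                  freeFlight (Torus.geometry (Fin 3)) (Alexander.freeExitTime (Torus.geometry (Fin 3))
                      (hsDiameter σ N) (Alexander.stateAfter (Torus.geometry (Fin 3)) (hsDiameter σ N)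
                      z m)).toReal (Alexander.stateAfter (Torus.geometry (Fin 3)) (hsDiameter σ N) z m) ∈
                    contactSet (Torus.geometry (Fin 3)) (N + 1) (hsDiameter σ N) i j ∧
                  IsIncoming (Torus.geometry (Fin 3)) (freeFlight (Torus.geometry (Fin 3))
                    (Alexander.freeExitTime (Torus.geometry (Fin 3)) (hsDiameter σ N)
                      (Alexander.stateAfter (Torus.geometry (Fin 3)) (hsDiameter σ N) z m)).toReal
                    (Alexander.stateAfter (Torus.geometry (Fin 3)) (hsDiameter σ N) z m)) i j
                then 1 + ‖((freeFlight (Torus.geometry (Fin 3)) (Alexander.freeExitTime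
                      (Torus.geometry (Fin 3)) (hsDiameter σ N) (Alexander.stateAfter
                      (Torus.geometry (Fin 3)) (hsDiameter σ N) z m)).toReal
                      (Alexander.stateAfter (Torus.geometry (Fin 3)) (hsDiameter σ N) z m)) i).2 -
                    ((freeFlight (Torus.geometry (Fin 3)) (Alexander.freeExitTime
                      (Torus.geometry (Fin 3)) (hsDiameter σ N) (Alexander.stateAfter
                      (Torus.geometry (Fin 3)) (hsDiameter σ N) z m)).toReal
                      (Alexander.stateAfter (Torus.geometry (Fin 3)) (hsDiameter σ N) z m)) j).2‖ ^ 3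
                else 0))
          ∂(localGibbsLaw σ (fun _ => a) (fun _ => u) (fun _ => θ) N (Φ N)) ≤ ENNReal.ofReal C := by
  obtain ⟨σ₀, hσ₀, hsmall⟩ := exists_smallDensity uniformProfile one_pos
  refine ⟨σ₀, hσ₀, fun σ hσ hσlt Φ t ht => ?_⟩
  have hsm : SmallDensity uniformProfile σ := (hsmall σ hσ hσlt).1
  -- the mark, its Gaussian flux moment and the constant
  set b : V3 × V3 → ℝ≥0∞ := fun p => ENNReal.ofReal (1 + ‖p.1 - p.2‖ ^ 3) with hb
  have hbm : Measurable b := by rw [hb]; fun_prop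
  set I : ℝ≥0∞ := ∫⁻ p, ENNReal.ofReal ‖p.2 - p.1‖ * b p
    ∂((gaussMeasure u θ).prod (gaussMeasure u θ)) with hI
  have hItop : I ≠ ⊤ := lintegral_cubicFluxMoment_ne_top u θ
  have hIeq : I = ENNReal.ofReal I.toReal := (ENNReal.ofReal_toReal hItop).symm
  set τ : ℝ := t + 1 with hτdef
  have hτ0 : 0 < τ := by rw [hτdef]; linarith
  have htτ : t ≤ τ := by rw [hτdef]; linarith
  refine ⟨16 * τ * σ ^ 2 * I.toReal, fun N => ?_⟩
  rcases Nat.eq_zero_or_pos N with rfl | hNpos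
  · -- one sphere: no pair `i < j`, the sum vanishes identically
    have hnot : ∀ (i j : Fin (0 + 1)) (Q : Prop), (i < j ∧ Q) ↔ False := by
      intro i j Q
      simp only [iff_false, not_and]
      intro hij
      exact absurd (Fin.lt_def.1 hij) (by have := i.2; have := j.2; omega)
    simp only [hnot, if_false, Finset.sum_const_zero, mul_zero, ENNReal.ofReal_zero, lintegral_const,
      zero_mul]
    exact zero_le
  -- `N ≥ 1`
  have hN : 1 ≤ N := hNpos
  have hε2 : hsDiameter σ N < 2⁻¹ := by
    have h1 := hsDiameter_le hσ.le N
    have h2 := hsm.σ_lt_half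
    rw [inv_eq_one_div]
    linarith
  have hG := Torus.isHardSphereRegular_geometry (d := Fin 3) hε2
  set P := localGibbsLaw σ (fun _ => a) (fun _ => u) (fun _ => θ) N (Φ N) with hP
  have hgood : ∀ᵐ z ∂P, z ∈ (Φ N).good := ae_mem_good_localGibbsLaw σ _ _ _ N (Φ N)
  have hc : 0 ≤ ((N : ℝ) + 1) ^ (-(4 / 3 : ℝ)) := Real.rpow_nonneg (by positivity) _
  -- the mean form of the collision-flux window bound for the mark `b`
  have hflux := lintegral_indicator_collisionMarkSum_le hsm.σ_lt_half.le ha hθ u (Φ N)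
    (measurePreserving_flow_localGibbsLaw_const σ a θ u N (Φ N))
    (fun i j hij T hT => posGibbs_pairEvent_le hsm hN hij hT)
    (fun h hh => exists_sweptTube (hsDiameter_pos hσ N) hh)
    (fun S hS => by simpa only [sub_zero] using volume_setOf_exists_reprSym_add_latticeVec_mem_le 0 hS)
    hτ0 hbm
  -- the constants: `(N+1)^{-4/3} · 16 τ (N+1)² ε² · I = 16 τ σ² I`
  have harith : ENNReal.ofReal (((N : ℝ) + 1) ^ (-(4 / 3 : ℝ))) *
      (ENNReal.ofReal (16 * τ * ((N + 1 : ℕ) : ℝ) ^ 2 * hsDiameter σ N ^ 2) * I) =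
      ENNReal.ofReal (16 * τ * σ ^ 2 * I.toReal) := by
    rw [hIeq, ENNReal.toReal_ofReal ENNReal.toReal_nonneg, ← mul_assoc,
      ← ENNReal.ofReal_mul hc, ← ENNReal.ofReal_mul (by positivity)]
    congr 1
    have h := rpow_mul_sq_mul_hsDiameter_sq σ N
    calc ((N : ℝ) + 1) ^ (-(4 / 3 : ℝ)) * (16 * τ * ((N + 1 : ℕ) : ℝ) ^ 2 * hsDiameter σ N ^ 2) * I.toReal
        = 16 * τ * (((N : ℝ) + 1) ^ (-(4 / 3 : ℝ)) * ((N + 1 : ℕ) : ℝ) ^ 2 * hsDiameter σ N ^ 2) *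
            I.toReal := by ring
      _ = 16 * τ * σ ^ 2 * I.toReal := by rw [h]
  rw [← harith]
  -- pathwise domination on the good set (the bridge) and integration
  refine lintegral_ofReal_mul_le P hc hgood hflux fun z hz => ?_
  refine ofReal_hitSum_le_collisionSum_flow hG (Φ N) hz ht htτ
    (fun y i j => 1 + ‖(y i).2 - (y j).2‖ ^ 3) (fun y i j => by positivity)
    (fun w i j => b ((w i).2, (w j).2)) fun y p hp => ?_
  -- the mark is a collision invariant: `‖vᵢ' − vⱼ'‖ = ‖vᵢ − vⱼ‖`
  show ENNReal.ofReal (1 + ‖(y p.1).2 - (y p.2).2‖ ^ 3) ≤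
    ENNReal.ofReal (1 + ‖(collidePair (Torus.geometry (Fin 3)) p.1 p.2 y p.1).2 -
      (collidePair (Torus.geometry (Fin 3)) p.1 p.2 y p.2).2‖ ^ 3)
  rw [norm_vel_sub_vel_collidePair _ hp.ne y]

end Summit.AtomisticToContinuum.HydrodynamicLimit.Theorems.LambertianContactSwapCollisionMomentBound

end
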